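import Literature.MathematicalPhysics.QuantumFieldTheory.Balaban1983to89.B8Eq137QjEqB
import Literature.MathematicalPhysics.QuantumFieldTheory.Balaban1983to89.B8ConstraintBonds

/-!
# `Balaban1983to89.B8Eq131DomainSeq` — [Balaban1985RegularSpaces] p. 82, the crossing-bond geometry of (1.31)/(1.37)
# «All sites of the contours Γ_{b₋,x} belong to Λ_{j−1}» DERIVED from the admissibility record (1.3)–(1.6)
# (`B8ConstraintBonds.DomainSeq` / `Lam`) on the `ℤᵈ` carriers — the block hypothesis `hblock` of `B8Eq137QjEqB` §8 and
# of `B8Eq131Derivation` §5 discharged for an admissible domain sequence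

statement-level skeleton of published theorems with citation tags; proofs where landed; nothing here is a claim
about the Yang–Mills mass gap

PDF held: `paper:balaban1985-cmp99-regular-spaces-gauge-fixing` (journal page = PDF page + 74); pages read for this module:
p. 82 [PDF 8] AS AN IMAGE (render `…-p008-x2.png`, this session), p. 77 [PDF 3] and p. 81 [PDF 7] from the `lit read` text
layer.

CITATION HEADER (lean-in-tree rule).  Cell `lit-balaban` (HOME `run/shared/lean/pub/lit-balaban/`), unit `lit-balaban-r05`
gen 12 (B8 fold owner).  WHAT IS REPRODUCED = SKELETON rows **B8.Eq1.31** ((1.30)–(1.31); cell status «proved … (partial: …;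
absent: the same displays on print's own carriers … with the admissibility geometry (B(b₋) ⊂ Λ_{j−1} at a crossing bond …)
DERIVED from (1.3)–(1.6) instead of entered as the site-wise and block-wise hypotheses …)») and **B8.Eq1.36** ((1.37) line), inputs
**B8.Eq1.3** / **B8.Eq1.5** ((1.3)–(1.6): the tree's `ℤᵈ` record `B8ConstraintBonds.DomainSeq L Ω` — `anti` (1.3),
`sat` «Ω_j = Bʲ(Ω_j^{(j)})», `sep` = the `L^{j+1}`-collar consequence of (1.4) «(Lʲη)⁻¹dist(Ω_jᶜ, Ω_{j+1}) > RM₁», `RM₁ ≥ L` —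
and `B8ConstraintBonds.Lam L Ω j` = (1.5) «Λ_j = Ω_j^{(j)} ∖ Ω_{j+1}^{(j)}» as level-`j` POINTS of `ℤᵈ`).  THIS MODULE derives,
from that record alone, the one geometric fact the parents `B8Eq131Derivation` (§5, hypothesis `h87` on the block) and
`B8Eq137QjEqB` (§8, hypothesis `hblock`) ask at a crossing bond: print's sentence p. 82 *"All sites of the contours Γ_{b₋,x}
belong to Λ_{j−1}"* — every site of the block `B(b₋)` under the outer end-point of a bond crossing `∂Λ_j` lies in `Λ_{j−1}`.
Kind «kernel-checked proof», theorems only; no `… : Prop` fact, no definition; no existing module is modified; REUSED BY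
NAME: `B8ConstraintBonds.DomainSeq/Lam/IsLevel`, `QuantumLattice.blockMap/blockBase/blockMap_blockBase_add_of_lt`,
`B8Eq137QjEqB.*_of_inAx_restr129`, `B8Eq131Derivation.eq131_crossing/eq131_crossing_mirrored/eq87_of_inAx_restr129`.

WHAT IS PRINTED (p. 81–82, render/text layer).  *"If a bond b crosses the boundary of Λ_j, then one of the end-points
belongs to Λ_j, e.g. b₊ ∈ Λ_j, and another to Λ_jᶜ, b₋ ∈ Λ_{j−1}. In this case the formulas (97), (99), and (87) of [3] imply
(Ũ₁^{u j})_b = \overline{R̄^{j−1}_{0,b₋}Ū₁^{j−1}}(Ū₁ʲ)_b, where by the formula (105) of [3] \overline{R̄^{j−1}_{0,b₋}Ū₁^{j−1}} =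
exp i Σ_{x∈B(b₋)} L^{−d}(1/i) log(R̄^{j−1}_{0,b₋}Ũ₁^{u,j−1})(Γ_{b₋,x}). All sites of the contours Γ_{b₋,x} belong to Λ_{j−1},
hence Ū₁^{j−1} in the above formula is equal to V(Ū₀^{j−1})⁻¹."*; p. 77 (1.3)–(1.6) *"Ω₀ ⊃ Ω₁ ⊃ … ⊃ Ω_k, Ω_j ⊂ T_η, (1.3) …
Ω_j = Bʲ(Ω_j^{(j)}), Ω_j is a sum of cubes of a size M₁Lʲη, (Lʲη)⁻¹dist(Ω_jᶜ, Ω_{j+1}) > RM₁. (1.4) … Λ_j = Ω_j^{(j)} ∖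
Ω_{j+1}^{(j)}, j = 0, 1, …, k−1, Λ_k = Ω_k^{(k)}, (1.5)"*.

DICTIONARY (nothing new).  The B7/B8 lineage reads a level-`j` site in RESCALED coordinates `y : Site d` (the fine point
is `Lʲ•y`: `B7AvgGaugeCovariance.uLev L u j y = u (Lʲ•y)`; the level-`j` sites under a level-`(j+1)` site `y` are the
`x` with `L•y ≤ x ≤ L•y + (L−1)`, `B7Prop1Local.InBox`/`B8Thm2LogB.blockTop`), while `B8ConstraintBonds` records `Ω_j`, `Λ_j`
as sets of FINE points of `ℤᵈ`.  The dictionary is stated, never defined: a family `Λ : ℕ → Set (Site d)` in rescaled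
coordinates READS the record `Ω` when `y ∈ Λ j ↔ Lʲ•y ∈ Lam L Ω j` (hypothesis `hΛ` of §3); print's «b₋ ∈ Λ_{j−1}» for the
outer end-point `y` of a level-`(j+1)` bond is `L•y ∈ Λ j` (the same point, read one level down), «b₊ ∈ Λ_j» is
`y + e_κ ∈ Λ (j+1)` (tree levels = print's levels + 1 at a crossing bond, as in the parents).

WHAT THIS MODULE PROVES (all statements kernel-checked, 0 sorry).
§1 Block arithmetic: `blockMap_pow_smul_of_inBox` (a level-`j` site `x` under `y` has fine point `Lʲ•x` in the
   `L^{j+1}`-block of `y`), `isLevel_pow_smul` (+ private helpers `pow_smul_eq_blockBase`, `pow_succ_smul_eq`,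
   `blockMap_pow_smul_self`).
§2 THE PRINTED SENTENCE from (1.3)–(1.6): **`block_mem_Lam_of_crossing`** — under `DomainSeq L Ω`, `L ≥ 1`, if the fine
   point `L^{j+1}•z` of a NEIGHBOUR `z = y + e_κ` of `y` lies in `Ω_{j+1}` and `L^{j+1}•y ∉ Ω_{j+1}`, then EVERY level-`j`
   site `x` under `y` has `Lʲ•x ∈ Λ_j` (`∈ Ω_j` by `sep` from `L^{j+1}•z`, at sup-distance `≤ L^{j+1}`; `∉ Ω_{j+1}` by `sat`,
   being in the block of `y`; a level-`j` point trivially); **`block_mem_Lam_of_crossing_mirrored`** — the same for the block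
   under `y + e_κ` when `L^{j+1}•y ∈ Ω_{j+1}` and `L^{j+1}•(y + e_κ) ∉ Ω_{j+1}` (`sep` from the far corner
   `L^{j+1}•y + (L^{j+1} − 1)e_κ` of the block of `y`, which lies in `Ω_{j+1}` by `sat`); `not_mem_succ_of_mem_Lam_smul` («b₋ ∈
   Λ_{j−1}» read one level down ⇒ `L^{j+1}•y ∉ Ω_{j+1}`).
§3 CONSEQUENCES for the parents, for a family `Λ` reading the record (`hΛ`): `hblock_of_domainSeq` /
   `hblock_of_domainSeq_mirrored` (the hypothesis `hblock` of `B8Eq137QjEqB` §8 from «b₋ ∈ Λ_{j−1}, b₊ ∈ Λ_j»), and the (1.37)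
   statements with the geometry DERIVED: **`Qj_eq_Bcross_of_domainSeq`**, **`Qj_eq_BcrossMirror_of_domainSeq`**,
   **`norm_Qj_lt_crossing_of_domainSeq`** (= `B8Eq137QjEqB.Qj_eq_Bcross_of_inAx_restr129` / `…BcrossMirror…` /
   `norm_Qj_lt_crossing_of_inAx_restr129` with `hblock` discharged), and at the parent's level **`eq131_crossing_of_domainSeq`**
   ((1.31) second line `B8Eq131Derivation.eq131_crossing` with its block-(87) hypothesis discharged from `InAx`/`Restr129` +
   `DomainSeq`).

HONEST SCOPE.  (i) `ℤᵈ` record of (1.3)–(1.6) (`DomainSeq`: only `sat` and ONE collar layer of `sep` are used; the cube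
size `M₁Lʲη` and `R` play no role), not print's `T_η`; `Ω 0 = Set.univ` models `Ω₀ = T_η` where a user wants it (not
needed here).  (ii) Only the geometry of the TWO printed crossing orientations is derived; the tower hypothesis (1.19)
(`InAx`) and (1.29) (`Restr129`) remain the typed classes of the parents (they are conditions on the configurations, not
geometry); bonds leaving `𝔅_k` towards the coarser region (`B8ConstraintBonds.not_mem_Bk_of_exit`, cell item G-adv8-10 (a))
are not touched.  (iii) Nothing here is progress on `Summit.QuantumFields`; the value is that the «absent:» clause of row
B8.Eq1.31 shrinks: at a crossing bond the block geometry is now derived from the (1.3)–(1.6) record rather than assumed.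

[cite: Balaban1985RegularSpaces, p.82 («All sites of the contours Γ_{b₋,x} belong to Λ_{j−1}»), (1.31) p.82, (1.37) p.82,
(1.3)–(1.6) p.77, (1.29) p.81, (1.19) p.79]
-/

noncomputable section

open NormedSpace Finset Complex

namespace Literature.MathematicalPhysics.QuantumFieldTheory.Balaban1983to89.B8Eq131DomainSeq

open Literature.MathematicalPhysics.QuantumLattice (blockMap blockBase blockMap_blockBase_add_of_lt)
open B7Prop1Explicit B7Prop2Explicit MatrixLog B7Eq92Concrete B7Eq99Concrete B7Eq84Concrete B7AvgGaugeCovariance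
open B7Prop3Flat (expCfg c3)
open B7Prop4GeneralLevels (logCovIter)
open B7Prop1Local (InBox)
open B8Lemma1NonAbelian (pert)
open B8Thm2LogB (blockTop crossMid Bcross BcrossMirror)
open B8Eq131Derivation (eq131_crossing eq131_crossing_mirrored eq87_of_inAx_restr129)
open B8Eq119TwistedAxial (InAx Restr129)
open B8ConstraintBonds (DomainSeq Lam IsLevel)
open B8Eq137QjEqB (Qj_eq_Bcross_of_inAx_restr129 Qj_eq_BcrossMirror_of_inAx_restr129
  norm_Qj_lt_crossing_of_inAx_restr129)

-- `Site` alone would resolve to the torus sites of `Setup.lean`; re-export the `ℤ^d` sites of `B7Prop1Explicit`.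
export B7Prop1Explicit (Site)

variable {d : ℕ}

/-! ## §1 Block arithmetic between the rescaled level coordinates and the fine points of `ℤᵈ` -/

/-- The fine point of a rescaled level-`n` site: `Lⁿ•y = blockBase (Lⁿ) y`. [folklore] -/
private theorem pow_smul_eq_blockBase (L n : ℕ) (y : Site d) : ((L : ℤ) ^ n) • y = blockBase (L ^ n) y := by
  funext i
  simp [blockBase]

/-- `L^{j+1}•y = Lʲ•(L•y)` (reading a level-`(j+1)` site one level down). [folklore] -/
private theorem pow_succ_smul_eq (L j : ℕ) (y : Site d) : ((L : ℤ) ^ (j + 1)) • y = ((L : ℤ) ^ j) • ((L : ℤ) • y) := by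
  rw [smul_smul, pow_succ]

/-- `Lʲ•x` is a level-`j` point. [cite: Balaban1985RegularSpaces, (1.5) p.77] -/
theorem isLevel_pow_smul (L j : ℕ) (x : Site d) : IsLevel L j (((L : ℤ) ^ j) • x) := fun i => by
  simp only [Pi.smul_apply, smul_eq_mul]
  exact dvd_mul_right _ _

/-- **A level-`j` site `x` under the level-`(j+1)` site `y` (`L•y ≤ x ≤ L•y + (L−1)`) has its fine point `Lʲ•x` in the
`L^{j+1}`-block of `y`**: `blockMap (L^{j+1}) (Lʲ•x) = y`. [cite: Balaban1985RegularSpaces, (1.4) p.77 («Ω_j = Bʲ(Ω_j^{(j)})»)] -/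
theorem blockMap_pow_smul_of_inBox {L : ℕ} (hL : 1 ≤ L) (j : ℕ) {y x : Site d}
    (hx : InBox ((L : ℤ) • y) ((L : ℤ) • y + blockTop L) x) :
    blockMap (L ^ (j + 1)) (((L : ℤ) ^ j) • x) = y := by
  have hLj : (0 : ℤ) < (L : ℤ) ^ j := pow_pos (by exact_mod_cast hL) j
  set t : Site d := ((L : ℤ) ^ j) • x - blockBase (L ^ (j + 1)) y with ht
  have hsplit : ((L : ℤ) ^ j) • x = blockBase (L ^ (j + 1)) y + t := by rw [ht]; abel
  have hti : ∀ i, t i = (L : ℤ) ^ j * (x i - (L : ℤ) * y i) := fun i => by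
    simp only [ht, Pi.sub_apply, Pi.smul_apply, smul_eq_mul, blockBase]
    push_cast
    ring
  rw [hsplit]
  refine blockMap_blockBase_add_of_lt _ _ _ (fun i => ?_) (fun i => ?_)
  · rw [hti]
    have h1 := (hx i).1
    simp only [Pi.smul_apply, smul_eq_mul] at h1
    exact mul_nonneg hLj.le (by linarith)
  · rw [hti]
    have h2 := (hx i).2
    simp only [Pi.add_apply, Pi.smul_apply, smul_eq_mul, blockTop] at h2
    have h3 : x i - (L : ℤ) * y i ≤ (L : ℤ) - 1 := by linarith
    calc (L : ℤ) ^ j * (x i - (L : ℤ) * y i) ≤ (L : ℤ) ^ j * ((L : ℤ) - 1) :=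
          mul_le_mul_of_nonneg_left h3 hLj.le
      _ < (L : ℤ) ^ j * (L : ℤ) := by nlinarith
      _ = ((L ^ (j + 1) : ℕ) : ℤ) := by push_cast; ring

/-- `blockMap (L^{j+1}) (L^{j+1}•y) = y`. [folklore] -/
private theorem blockMap_pow_smul_self {L : ℕ} (hL : 1 ≤ L) (n : ℕ) (y : Site d) :
    blockMap (L ^ n) (((L : ℤ) ^ n) • y) = y := by
  have h0 : (0 : ℤ) < ((L ^ n : ℕ) : ℤ) := by exact_mod_cast pow_pos hL n
  have hsplit : ((L : ℤ) ^ n) • y = blockBase (L ^ n) y + 0 := by rw [add_zero, pow_smul_eq_blockBase]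
  rw [hsplit]
  exact blockMap_blockBase_add_of_lt _ _ _ (fun _ => le_rfl) (fun _ => h0)

/-! ## §2 «All sites of the contours Γ_{b₋,x} belong to Λ_{j−1}» from (1.3)–(1.6) -/

/-- «b₋ ∈ Λ_{j−1}» READ ONE LEVEL DOWN gives `b₋ ∉ Ω_j`: if `Lʲ•(L•y) ∈ Λ_j` (the level-`(j+1)` site `y` read as a level-`j`
point of `Λ_j`) then `L^{j+1}•y ∉ Ω_{j+1}`. [cite: Balaban1985RegularSpaces, (1.5) p.77, p.82] -/
theorem not_mem_succ_of_mem_Lam_smul {L : ℕ} {Ω : ℕ → Set (Site d)} {j : ℕ} {y : Site d}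
    (h : ((L : ℤ) ^ j) • ((L : ℤ) • y) ∈ Lam L Ω j) : ((L : ℤ) ^ (j + 1)) • y ∉ Ω (j + 1) := by
  rw [pow_succ_smul_eq]
  exact h.2.2

/-- **p. 82 «All sites of the contours Γ_{b₋,x} belong to Λ_{j−1}», printed orientation, DERIVED from (1.3)–(1.6)**: under
`DomainSeq L Ω` (`L ≥ 1`), for a level-`(j+1)` bond `b = ⟨y, y + e_κ⟩` with `b₊`'s fine point in `Ω_{j+1}` and `b₋`'s fine
point outside `Ω_{j+1}`, EVERY level-`j` site `x` of the block `B(b₋)` under `y` has `Lʲ•x ∈ Λ_j` — in `Ω_j` by the collar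
`sep` (sup-distance `≤ L^{j+1}` from `L^{j+1}•(y + e_κ)`), outside `Ω_{j+1}` by the saturation `sat` (same `L^{j+1}`-block
as `b₋`), and a level-`j` point. [cite: Balaban1985RegularSpaces, p.82 («All sites of the contours Γ_{b₋,x} belong to Λ_{j−1}»), (1.3)–(1.6) p.77] -/
theorem block_mem_Lam_of_crossing {L : ℕ} (hL : 1 ≤ L) {Ω : ℕ → Set (Site d)} (hΩ : DomainSeq L Ω) {j : ℕ}
    {y : Site d} {κ : Fin d} (hplus : ((L : ℤ) ^ (j + 1)) • (y + e κ) ∈ Ω (j + 1))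
    (hminus : ((L : ℤ) ^ (j + 1)) • y ∉ Ω (j + 1)) {x : Site d}
    (hx : InBox ((L : ℤ) • y) ((L : ℤ) • y + blockTop L) x) : ((L : ℤ) ^ j) • x ∈ Lam L Ω j := by
  have hLj : (0 : ℤ) < (L : ℤ) ^ j := pow_pos (by exact_mod_cast hL) j
  have hL1 : (1 : ℤ) ≤ (L : ℤ) := by exact_mod_cast hL
  have hpow : (L : ℤ) ^ (j + 1) = (L : ℤ) ^ j * L := pow_succ _ _
  have hjle : (L : ℤ) ^ j ≤ (L : ℤ) ^ (j + 1) := by rw [hpow]; nlinarith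
  refine ⟨isLevel_pow_smul L j x, ?_, fun hmem => hminus ?_⟩
  · -- `sep` from `L^{j+1}•(y + e_κ) ∈ Ω_{j+1}` with `t = Lʲ•x − L^{j+1}•(y + e_κ)`, `|t_i| ≤ L^{j+1}`
    have h := hΩ.sep j (((L : ℤ) ^ (j + 1)) • (y + e κ)) (((L : ℤ) ^ j) • x - ((L : ℤ) ^ (j + 1)) • (y + e κ))
      hplus (fun i => ?_)
    · simpa using h
    · have h1 := (hx i).1
      have h2 := (hx i).2
      simp only [Pi.add_apply, Pi.smul_apply, smul_eq_mul, blockTop] at h1 h2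
      -- `L^{j+1} y_i ≤ Lʲ x_i ≤ L^{j+1} y_i + L^{j+1} − Lʲ`
      have hlo : (L : ℤ) ^ (j + 1) * y i ≤ (L : ℤ) ^ j * x i := by
        rw [hpow, mul_assoc]; exact mul_le_mul_of_nonneg_left h1 hLj.le
      have hhi : (L : ℤ) ^ j * x i ≤ (L : ℤ) ^ (j + 1) * y i + ((L : ℤ) ^ (j + 1) - (L : ℤ) ^ j) := by
        have := mul_le_mul_of_nonneg_left h2 hLj.le
        rw [hpow]; linarith [this]
      simp only [Pi.sub_apply, Pi.add_apply, Pi.smul_apply, smul_eq_mul, e_apply]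
      rw [abs_le]
      split_ifs with hi
      · constructor <;> linarith
      · constructor <;> linarith
  · -- `sat`: `Lʲ•x` and `L^{j+1}•y` lie in the same `L^{j+1}`-block
    exact hΩ.sat (j + 1) (((L : ℤ) ^ j) • x) _
      (by rw [blockMap_pow_smul_of_inBox hL j hx, blockMap_pow_smul_self hL (j + 1) y]) hmem

/-- **The mirrored orientation**: `b₋`'s fine point `L^{j+1}•y ∈ Ω_{j+1}`, `b₊ = y + e_κ` outside; then every level-`j` site
`x` of the block `B(b₊)` under `y + e_κ` has `Lʲ•x ∈ Λ_j` (`sep` from the far corner `L^{j+1}•y + (L^{j+1} − 1)e_κ` of the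
block of `b₋`, itself in `Ω_{j+1}` by `sat`). [cite: Balaban1985RegularSpaces, p.82, (1.3)–(1.6) p.77] -/
theorem block_mem_Lam_of_crossing_mirrored {L : ℕ} (hL : 1 ≤ L) {Ω : ℕ → Set (Site d)} (hΩ : DomainSeq L Ω)
    {j : ℕ} {y : Site d} {κ : Fin d} (hplus : ((L : ℤ) ^ (j + 1)) • y ∈ Ω (j + 1))
    (hminus : ((L : ℤ) ^ (j + 1)) • (y + e κ) ∉ Ω (j + 1)) {x : Site d}
    (hx : InBox ((L : ℤ) • (y + e κ)) ((L : ℤ) • (y + e κ) + blockTop L) x) : ((L : ℤ) ^ j) • x ∈ Lam L Ω j := by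
  have hLj : (0 : ℤ) < (L : ℤ) ^ j := pow_pos (by exact_mod_cast hL) j
  have hLj1 : (0 : ℤ) < (L : ℤ) ^ (j + 1) := pow_pos (by exact_mod_cast hL) (j + 1)
  have hL1 : (1 : ℤ) ≤ (L : ℤ) := by exact_mod_cast hL
  have hpow : (L : ℤ) ^ (j + 1) = (L : ℤ) ^ j * L := pow_succ _ _
  have hjle : (L : ℤ) ^ j ≤ (L : ℤ) ^ (j + 1) := by rw [hpow]; nlinarith
  refine ⟨isLevel_pow_smul L j x, ?_, fun hmem => hminus ?_⟩
  · -- the far corner `q = L^{j+1}•y + (L^{j+1} − 1)e_κ` of the block of `b₋` lies in `Ω_{j+1}` (`sat`)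
    set q : Site d := ((L : ℤ) ^ (j + 1)) • y + (((L : ℤ) ^ (j + 1) - 1) • e κ) with hq
    have hq_mem : q ∈ Ω (j + 1) := by
      refine hΩ.sat (j + 1) (((L : ℤ) ^ (j + 1)) • y) q ?_ hplus
      rw [blockMap_pow_smul_self hL (j + 1) y, hq, pow_smul_eq_blockBase]
      refine (blockMap_blockBase_add_of_lt _ _ _ (fun i => ?_) (fun i => ?_)).symm
      · simp only [Pi.smul_apply, smul_eq_mul, e_apply]
        split_ifs <;> nlinarith
      · simp only [Pi.smul_apply, smul_eq_mul, e_apply]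
        push_cast
        split_ifs <;> nlinarith
    -- `sep` from `q` with `t = Lʲ•x − q`, `|t_i| ≤ L^{j+1}`
    have h := hΩ.sep j q (((L : ℤ) ^ j) • x - q) hq_mem (fun i => ?_)
    · simpa using h
    · have h1 := (hx i).1
      have h2 := (hx i).2
      simp only [Pi.add_apply, Pi.smul_apply, smul_eq_mul, blockTop, e_apply] at h1 h2
      -- `L^{j+1}(y_i + δ) ≤ Lʲ x_i ≤ L^{j+1}(y_i + δ) + L^{j+1} − Lʲ`, `δ = [i = κ]`
      have hlo : (L : ℤ) ^ (j + 1) * (y i + if i = κ then 1 else 0) ≤ (L : ℤ) ^ j * x i := by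
        rw [hpow, mul_assoc]; exact mul_le_mul_of_nonneg_left h1 hLj.le
      have hhi : (L : ℤ) ^ j * x i
          ≤ (L : ℤ) ^ (j + 1) * (y i + if i = κ then 1 else 0) + ((L : ℤ) ^ (j + 1) - (L : ℤ) ^ j) := by
        have := mul_le_mul_of_nonneg_left h2 hLj.le
        rw [hpow]; linarith [this]
      simp only [hq, Pi.sub_apply, Pi.add_apply, Pi.smul_apply, smul_eq_mul, e_apply]
      rw [abs_le]
      split_ifs at hlo hhi ⊢ with hi
      · constructor <;> linarith
      · constructor <;> linarith
  · exact hΩ.sat (j + 1) (((L : ℤ) ^ j) • x) _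
      (by rw [blockMap_pow_smul_of_inBox hL j hx, blockMap_pow_smul_self hL (j + 1) (y + e κ)]) hmem

/-! ## §3 Consequences: the block hypotheses of `B8Eq137QjEqB` §8 and `B8Eq131Derivation` §5 discharged -/

/-- **The hypothesis `hblock` of `B8Eq137QjEqB.Qj_eq_Bcross_of_inAx_restr129` from «b₋ ∈ Λ_{j−1}, b₊ ∈ Λ_j»**: for a
family `Λ` in rescaled coordinates READING the record (`y ∈ Λ j ↔ Lʲ•y ∈ Lam L Ω j`), `DomainSeq L Ω`, `L ≥ 1`: if
`L•y ∈ Λ j` (b₋ read one level down) and `y + e_κ ∈ Λ (j+1)` (b₊), then every level-`j` site under `y` lies in `Λ j`.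
[cite: Balaban1985RegularSpaces, p.82, (1.3)–(1.6) p.77] -/
theorem hblock_of_domainSeq {L : ℕ} (hL : 1 ≤ L) {Ω : ℕ → Set (Site d)} (hΩ : DomainSeq L Ω)
    (Λ : ℕ → Set (Site d)) (hΛ : ∀ j y, y ∈ Λ j ↔ ((L : ℤ) ^ j) • y ∈ Lam L Ω j) {j : ℕ} {y : Site d}
    {κ : Fin d} (hminus : (L : ℤ) • y ∈ Λ j) (hplus : y + e κ ∈ Λ (j + 1)) :
    ∀ x : Site d, InBox ((L : ℤ) • y) ((L : ℤ) • y + blockTop L) x → x ∈ Λ j := fun x hx =>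
  (hΛ j x).mpr (block_mem_Lam_of_crossing hL hΩ ((hΛ (j + 1) (y + e κ)).mp hplus).2.1
    (not_mem_succ_of_mem_Lam_smul ((hΛ j _).mp hminus)) hx)

/-- **The mirrored `hblock`** from «b₋ ∈ Λ_j, b₊ ∈ Λ_{j−1}» (`y ∈ Λ (j+1)`, `L•(y + e_κ) ∈ Λ j`): every level-`j` site under
`y + e_κ` lies in `Λ j`. [cite: Balaban1985RegularSpaces, p.82, (1.3)–(1.6) p.77] -/
theorem hblock_of_domainSeq_mirrored {L : ℕ} (hL : 1 ≤ L) {Ω : ℕ → Set (Site d)} (hΩ : DomainSeq L Ω)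
    (Λ : ℕ → Set (Site d)) (hΛ : ∀ j y, y ∈ Λ j ↔ ((L : ℤ) ^ j) • y ∈ Lam L Ω j) {j : ℕ} {y : Site d}
    {κ : Fin d} (hminus : y ∈ Λ (j + 1)) (hplus : (L : ℤ) • (y + e κ) ∈ Λ j) :
    ∀ x : Site d, InBox ((L : ℤ) • (y + e κ)) ((L : ℤ) • (y + e κ) + blockTop L) x → x ∈ Λ j := fun x hx =>
  (hΛ j x).mpr (block_mem_Lam_of_crossing_mirrored hL hΩ ((hΛ (j + 1) y).mp hminus).2.1
    (not_mem_succ_of_mem_Lam_smul ((hΛ j _).mp hplus)) hx)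

section Consequences

variable {𝔸 : Type*} [NormedRing 𝔸] [NormOneClass 𝔸] [NormedAlgebra ℂ 𝔸] [CompleteSpace 𝔸]

omit [NormOneClass 𝔸] in
/-- **(1.31), second line, with the block geometry DERIVED** (the parent's `B8Eq131Derivation.eq131_crossing` for the typed
classes (1.19) `InAx` / (1.29) `Restr129` over a family `Λ` reading an admissible record `DomainSeq L Ω`): for a
level-`(j+1)` bond with `b₋` read one level down in `Λ_j` (`L•y ∈ Λ j`) and `b₊ = y + e_κ ∈ Λ_{j+1}`, `j + 1 ≤ k`,
`(U̿₁^{j+1})_b = exp[−i Σ_{x∈B(b₋)} L^{−d} (1/i) log(R̄ʲ_{0,b₋}V′ⱼ)(Γ_{b₋,x})] · V_b(Ū₀^{j+1}_b)⁻¹`, where the (1.13)-data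
`Vj`, `V` are as in the parent. [cite: Balaban1985RegularSpaces, (1.31) p.82, p.82 («All sites …»), (1.3)–(1.6) p.77, (1.19) p.79, (1.29) p.81] -/
theorem eq131_crossing_of_domainSeq {L : ℕ} (hL : 1 ≤ L) {Ω : ℕ → Set (Site d)} (hΩ : DomainSeq L Ω)
    (Λ : ℕ → Set (Site d)) (hΛ : ∀ j y, y ∈ Λ j ↔ ((L : ℤ) ^ j) • y ∈ Lam L Ω j) (k : ℕ)
    (U₀ U₁ : Site d → Fin d → 𝔸ˣ) (u : Site d → 𝔸ˣ) (hAx : InAx L k Λ U₀ (mgauge U₀ u U₁ * U₀))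
    (h129 : Restr129 L k Λ U₀ u) {j : ℕ} (hjk : j + 1 ≤ k) (y : Site d) (κ : Fin d)
    (hminus : (L : ℤ) • y ∈ Λ j) (hplus : y + e κ ∈ Λ (j + 1)) (Vj V : Site d → Fin d → 𝔸ˣ)
    (h13j : B7Prop1Local.AgreeOn ((L : ℤ) • y) ((L : ℤ) • y + blockTop L) (avgIter L (mgauge U₀ u U₁ * U₀) j) Vj)
    (h13 : avgIter L (mgauge U₀ u U₁ * U₀) (j + 1) y κ = V y κ) :
    ((dbavgCovIter L U₀ U₁ (j + 1) y κ : 𝔸ˣ) : 𝔸)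
      = crossMid L (avgIter L U₀ j) (pert Vj (avgIter L U₀ j)) ((L : ℤ) • y)
          (V y κ * (avgIter L U₀ (j + 1) y κ)⁻¹) :=
  have h87 := eq87_of_inAx_restr129 L hL k Λ U₀ U₁ u hAx h129
  eq131_crossing L hL U₀ U₁ u j y κ Vj V
    (fun x hx => h87 j (Nat.le_of_succ_le hjk) x (hblock_of_domainSeq hL hΩ Λ hΛ hminus hplus x hx))
    h13j (h87 (j + 1) hjk (y + e κ) hplus) h13

/-- **(1.37) «Q_j(U₀, ηA) = B», crossing bond, geometry DERIVED**: `B8Eq137QjEqB.Qj_eq_Bcross_of_inAx_restr129` with its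
`hblock` supplied by `hblock_of_domainSeq` — hypotheses: [3] Prop. 4's regime (as there), `InAx`, `Restr129` over a family `Λ`
reading `DomainSeq L Ω`, `L•y ∈ Λ j` (b₋ ∈ Λ_j one level down), `y + e_κ ∈ Λ (j+1)` (b₊).
[cite: Balaban1985RegularSpaces, (1.37) p.82, (1.31) p.82, p.82 («All sites …»), (1.3)–(1.6) p.77] -/
theorem Qj_eq_Bcross_of_domainSeq (L : ℕ) (hL : 2 ≤ L) {Ω : ℕ → Set (Site d)} (hΩ : DomainSeq L Ω)
    (Λ : ℕ → Set (Site d)) (hΛ : ∀ j y, y ∈ Λ j ↔ ((L : ℤ) ^ j) • y ∈ Lam L Ω j) {G : Subgroup 𝔸ˣ}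
    (hG : AvgClosed d L G) (k : ℕ) (U₀ : Site d → Fin d → 𝔸ˣ) (hU₀ : ∀ x κ, U₀ x κ ∈ G) {α₀ : ℝ} (hα₀ : 0 < α₀)
    (hα3 : C0 d * α₀ ≤ 1 / 3) (hα4 : 4 * α₀ ≤ c2' d L) (h40 : pdev U₀ < α₀ * (((L : ℝ) ^ k)⁻¹) ^ 2)
    (B₀ : Site d → Fin d → 𝔸) {b : ℝ} (hb : 0 ≤ b) (hB : ∀ x κ, ‖B₀ x κ‖ ≤ b)
    (hsm : Real.exp (4 * (800 * ((d : ℝ) + 1) ^ 2 * ((d : ℝ) + 4)) * α₀)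
      * (1 + 8 * (131072 * ((d : ℝ) + 1) ^ 2) * ((L : ℝ) ^ k * b)) ≤ 2)
    (hc₃ : 2 * ((L : ℝ) ^ k * b) ≤ c3 d L) (u : Site d → 𝔸ˣ)
    (hAx : InAx L k Λ U₀ (mgauge U₀ u (expCfg B₀) * U₀)) (h129 : Restr129 L k Λ U₀ u)
    {j : ℕ} (hjk : j + 1 ≤ k) (y : Site d) (κ : Fin d)
    (hminus : (L : ℤ) • y ∈ Λ j) (hplus : y + e κ ∈ Λ (j + 1)) :
    logCovIter L U₀ B₀ (j + 1) y κ
      = I • Bcross L (avgIter L U₀ j) (tildIter L U₀ (mgauge U₀ u (expCfg B₀)) j) ((L : ℤ) • y)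
          (tildIter L U₀ (mgauge U₀ u (expCfg B₀)) (j + 1) y κ) :=
  Qj_eq_Bcross_of_inAx_restr129 L hL hG k Λ U₀ hU₀ hα₀ hα3 hα4 h40 B₀ hb hB hsm hc₃ u hAx h129 hjk y κ
    (hblock_of_domainSeq (le_trans (by norm_num) hL) hΩ Λ hΛ hminus hplus) hplus

/-- **(1.37), mirrored crossing bond, geometry DERIVED** (`y ∈ Λ (j+1)` = b₋, `L•(y + e_κ) ∈ Λ j` = b₊ one level down).
[cite: Balaban1985RegularSpaces, (1.37) p.82, (1.31) p.82, (1.3)–(1.6) p.77] -/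
theorem Qj_eq_BcrossMirror_of_domainSeq (L : ℕ) (hL : 2 ≤ L) {Ω : ℕ → Set (Site d)} (hΩ : DomainSeq L Ω)
    (Λ : ℕ → Set (Site d)) (hΛ : ∀ j y, y ∈ Λ j ↔ ((L : ℤ) ^ j) • y ∈ Lam L Ω j) {G : Subgroup 𝔸ˣ}
    (hG : AvgClosed d L G) (k : ℕ) (U₀ : Site d → Fin d → 𝔸ˣ) (hU₀ : ∀ x κ, U₀ x κ ∈ G) {α₀ : ℝ} (hα₀ : 0 < α₀)
    (hα3 : C0 d * α₀ ≤ 1 / 3) (hα4 : 4 * α₀ ≤ c2' d L) (h40 : pdev U₀ < α₀ * (((L : ℝ) ^ k)⁻¹) ^ 2)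
    (B₀ : Site d → Fin d → 𝔸) {b : ℝ} (hb : 0 ≤ b) (hB : ∀ x κ, ‖B₀ x κ‖ ≤ b)
    (hsm : Real.exp (4 * (800 * ((d : ℝ) + 1) ^ 2 * ((d : ℝ) + 4)) * α₀)
      * (1 + 8 * (131072 * ((d : ℝ) + 1) ^ 2) * ((L : ℝ) ^ k * b)) ≤ 2)
    (hc₃ : 2 * ((L : ℝ) ^ k * b) ≤ c3 d L) (u : Site d → 𝔸ˣ)
    (hAx : InAx L k Λ U₀ (mgauge U₀ u (expCfg B₀) * U₀)) (h129 : Restr129 L k Λ U₀ u)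
    {j : ℕ} (hjk : j + 1 ≤ k) (y : Site d) (κ : Fin d)
    (hminus : y ∈ Λ (j + 1)) (hplus : (L : ℤ) • (y + e κ) ∈ Λ j) :
    logCovIter L U₀ B₀ (j + 1) y κ
      = I • BcrossMirror L (avgIter L U₀ j) (tildIter L U₀ (mgauge U₀ u (expCfg B₀)) j) ((L : ℤ) • (y + e κ))
          (avgIter L U₀ (j + 1) y κ) (tildIter L U₀ (mgauge U₀ u (expCfg B₀)) (j + 1) y κ) :=
  Qj_eq_BcrossMirror_of_inAx_restr129 L hL hG k Λ U₀ hU₀ hα₀ hα3 hα4 h40 B₀ hb hB hsm hc₃ u hAx h129 hjk y κ hminus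
    (hblock_of_domainSeq_mirrored (le_trans (by norm_num) hL) hΩ Λ hΛ hminus hplus)

/-- **(1.42) clause «|Q_j(U₀, ηA)| < 2dLα₁» from (1.35), crossing bond, geometry DERIVED**
(`B8Eq137QjEqB.norm_Qj_lt_crossing_of_inAx_restr129` with `hblock` from `hblock_of_domainSeq`).
[cite: Balaban1985RegularSpaces, (1.42) p.83, (1.37) p.82, (1.35) p.82, (1.3)–(1.6) p.77] -/
theorem norm_Qj_lt_crossing_of_domainSeq (L : ℕ) (hd : 1 ≤ d) (hL : 2 ≤ L) {Ω : ℕ → Set (Site d)}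
    (hΩ : DomainSeq L Ω) (Λ : ℕ → Set (Site d)) (hΛ : ∀ j y, y ∈ Λ j ↔ ((L : ℤ) ^ j) • y ∈ Lam L Ω j)
    {G : Subgroup 𝔸ˣ} (hG : AvgClosed d L G) (k : ℕ) (U₀ : Site d → Fin d → 𝔸ˣ) (hU₀ : ∀ x κ, U₀ x κ ∈ G)
    {α₀ : ℝ} (hα₀ : 0 < α₀) (hα3 : C0 d * α₀ ≤ 1 / 3) (hα4 : 4 * α₀ ≤ c2' d L)
    (h40 : pdev U₀ < α₀ * (((L : ℝ) ^ k)⁻¹) ^ 2) (B₀ : Site d → Fin d → 𝔸) {b : ℝ} (hb : 0 ≤ b)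
    (hB : ∀ x κ, ‖B₀ x κ‖ ≤ b)
    (hsm : Real.exp (4 * (800 * ((d : ℝ) + 1) ^ 2 * ((d : ℝ) + 4)) * α₀)
      * (1 + 8 * (131072 * ((d : ℝ) + 1) ^ 2) * ((L : ℝ) ^ k * b)) ≤ 2)
    (hc₃ : 2 * ((L : ℝ) ^ k * b) ≤ c3 d L) (u : Site d → 𝔸ˣ)
    (hAx : InAx L k Λ U₀ (mgauge U₀ u (expCfg B₀) * U₀)) (h129 : Restr129 L k Λ U₀ u)
    {j : ℕ} (hjk : j + 1 ≤ k) (y : Site d) (κ : Fin d)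
    (hminus : (L : ℤ) • y ∈ Λ j) (hplus : y + e κ ∈ Λ (j + 1))
    (hU : ∀ x μ, avgIter L (mgauge U₀ u (expCfg B₀) * U₀) j x μ ∈ U1 𝔸)
    (hW : avgIter L (mgauge U₀ u (expCfg B₀) * U₀) (j + 1) y κ ∈ U1 𝔸)
    {α₁ : ℝ} (hα : 0 < α₁) (hsmall : (d : ℝ) * L * α₁ ≤ 1 / 8)
    (h135 : ∀ (z : Site d) (μ : Fin d), (L : ℤ) • y ≤ z → z + e μ ≤ (L : ℤ) • y + blockTop L →
      ‖(avgIter L (mgauge U₀ u (expCfg B₀) * U₀) j z μ : 𝔸) - (avgIter L U₀ j z μ : 𝔸)‖ ≤ α₁)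
    (h135b : ‖(avgIter L (mgauge U₀ u (expCfg B₀) * U₀) (j + 1) y κ : 𝔸) - (avgIter L U₀ (j + 1) y κ : 𝔸)‖ ≤ α₁) :
    ‖logCovIter L U₀ B₀ (j + 1) y κ‖ < 2 * d * L * α₁ :=
  norm_Qj_lt_crossing_of_inAx_restr129 L hd hL hG k Λ U₀ hU₀ hα₀ hα3 hα4 h40 B₀ hb hB hsm hc₃ u hAx h129 hjk y κ
    (hblock_of_domainSeq (le_trans (by norm_num) hL) hΩ Λ hΛ hminus hplus) hplus hU hW hα hsmall h135 h135b

end Consequences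

end Literature.MathematicalPhysics.QuantumFieldTheory.Balaban1983to89.B8Eq131DomainSeq

end
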